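/-
Reproduction cell `pub-balaban`, paper sub-cell B04 (gen 9). Imports the gen-7/gen-8 walk kernels only.
Source under audit: T. Bałaban, *Regularity and decay of lattice Green's functions*, Commun. Math. Phys. 89
(1983) 571–597 — bib key `Balaban1983RegularityDecay` ("B4"). Journal page = PDF page + 570.
-/
import Literature.MathematicalPhysics.QuantumFieldTheory.Balaban1983to89.B4RandomWalkDelta112

/-!
# B4 (2.18)–(2.22): the `L^p` exponent chain — "the theorem ⇐ Lemmas 2.1, 2.2 + the representation (2.13)"

T. Bałaban, *Regularity and decay of lattice Green's functions*, Commun. Math. Phys. **89** (1983) 571–597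
[Balaban1983RegularityDecay], §2, pp. 577–579.  This module is a KERNEL CERTIFICATE OF PRINTED BOOKKEEPING: it
proves, over an abstract ring of operators acting on an abstract module of "functions" graded by a family of
seminorm-like functionals, that the bounds the paper REQUESTS from Lemma 2.1 ((2.15), `L² → L²`, every cube) and
Lemma 2.2 ((2.16) Hölder, (2.17) `L^p → L^q`, interior cubes only), fed through the random-walk representation
(2.13) of the convergent series (2.12), give the decay bound (2.22) — i.e. the implication
*"These two lemmas together with the representation (2.13) imply the theorem"* (p.578), with the mixed-norm
chain (2.21) made explicit.  Lemmas 2.1, 2.2, the series (2.12) and the locality behind (2.13) are HYPOTHESES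
here (they are the paper's analytic content, proved on pp. 579–597 and NOT reproduced); nothing in this file is
a claim about the Yang–Mills Green's functions themselves.

## The printed text certified here (verbatim, pp. 577–579)

* (2.17), Lemma 2.2, p.578: *"and a constant c₂ depending on d, p₁, such that
  ‖G_k(□,Ã)f‖_q, ‖D^η_{Ã,μ}G_k(□,Ã)f‖_q, ‖G_k(□,Ã)D^{η*}_{Ã,μ}f‖_q ≤ c₂‖f‖_p for 1 ≤ p, q ≤ ∞, satisfying the
  condition 1/p − 1/p₁ ≤ 1/q ≤ 1/p with p₁ > d."*
* p.578: *"These two lemmas together with the representation (2.13) imply the theorem. … We restrict the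
  summation in (2.13) to paths starting in the corresponding j's and we will prove the inequality (1.9) using
  the representation (2.13):
  (2.18) (the left hand side of (1.9)) ≤ Σ'_ω ‖h_{ω₀}G_k(□_{ω₀},Ã_{ω₀})h_{ω₀}K_{ω₁}G_k(□_{ω₁},Ã_{ω₁})h_{ω₂}"* ⟦sic:
  `h_{ω₁}`⟧ *"· … · K_{ω_n}G(□_{ω_n},Ã_{ω_n})h_{ω_n}f‖_{1,α}, where ω₀ and ω_n are each restricted to 2^d possible
  values of j by
  the conditions x, x' ∈ □_{ω₀}, supp f ⊂ □_{ω_n}. We do not know yet if the series on the right side of (2.18)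
  is convergent, and it will be one of the consequences of our estimates. Let us now take a positive integer
  n₀, we will fix it later, and let us define R₀ as
  (2.19) R₀ = (diameter of ∪_{ω=(ω₀,…,ω_{n₀}), ω₀=0} ∪_{i=1}^{n₀} □_{ω_i}) + 2M. …
  We divide the sum in (2.18) into two subsums: one with n ≤ n₀ and the other with n > n₀. The first is finite
  and the condition dist({x,x'},Ω^c) ≥ R₀, together with the definition (2.19) of R₀ imply that all □_{ω_i} are
  cubes contained in Ω. The same of course holds for the first n₀ elements of the sequences ω in the second
  sum. We estimate the first sum using Lemma 2.2 by
  (2.20) Σ'_{ω:n≤n₀} c₁‖K_{ω₁}G_k(□_{ω₁},Ã_{ω₁})h_{ω₁}‖_∞ · … · ‖K_{ω_n}G_k(□_{ω_n},Ã_{ω_n})h_{ω_n}‖_∞ ‖f‖_∞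
  ≤ Σ'_{ω:n≤n₀} c₁(c₂O(1)M^{−1})^n ‖f‖_∞.
  We apply Lemma 2.2 to the terms of the second sum also, more exactly we apply (2.17) with 1/p₁ = 1/(2n₀) and
  we fix n₀ such that p₁ = 2n₀ > d + 1, e.g. n₀ = d. We estimate the second sum by
  (2.21) Σ'_{ω:n>n₀} c₁‖K_{ω₁}G_k(□_{ω₁},Ã_{ω₁})h_{ω₁}‖_{∞,p₁} Π_{i=2}^{n₀} ‖K_{ω_i}G_k(□_{ω_i},Ã_{ω_i})h_{ω_i}‖
  _{p₁/(i−1), p₁/i} · Π_{i=n₀+1}^{n} ‖K_{ω_i}G_k(□_{ω_i},Ã_{ω_i})h_{ω_i}‖_{2,2} ‖f‖₂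
  ≤ Σ'_{ω:n>n₀} c₁(c₂O(1)M^{−1})^n ‖f‖_∞."*
* p.579: *"Here ‖T‖_{q,p} denotes a norm of an operator T : L^p → L^q. … The summation in (2.18) is restricted
  to paths ω satisfying x, x' ∈ □_{ω₀}, supp f ⊂ □_{ω_n}, so the length n satisfies n ≥ M^{−1}dist({x,x'}, supp
  f) − 2. There are at most 2^d(3^d)^{n−1}2^d of such paths, so finally we get the inequality
  (2.22) (the left hand side of (1.9)) ≤ Σ_n 2^d c₁(3^d c₂O(1)M^{−1})^n ‖f‖_∞ ≤ (2^{d+1}/e²) e^{−M^{−1}dist({x,x},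
  supp f)} ‖f‖_∞,"* ⟦sic: `dist({x,x'}, supp f)` is meant; and the tail `Σ_{n ≥ N} e^{−n} ≤ 2e^{−N}` with
  `N ≥ M^{−1}dist − 2` gives the prefactor `2^{d+1}·e^{+2}`, not `2^{d+1}/e²`; harmless, absorbed in `c₀` — see
  `tail_222`⟧ *"where n ≥ M^{−1}dist({x,x'},
  supp f) − 2, and if M is fixed such that 3^dc₂O(1)M^{−1} ≤ e^{−1}. Thus the inequality (1.9) is proved,
  similarly the inequalities (1.10)."*

## Dictionary (printed object ↦ Lean stand-in)

* the operators `h_jG_k(□_j,Ã_j)h_j` and `K_jG_k(□_j,Ã_j)h_j` of (2.13) ↦ ring elements `a j`, `b j : R` acting on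
  an `R`-module `E` of lattice functions by `•`; `G₀ = Σ_j a j`, `R = Σ_j b j`, `G_k(Ω,A) = Σ_n G₀Rⁿ` ((2.12)) ↦
  `HasSum (fun n => G₀ * Rop ^ n) G`; the "obvious fact" behind (2.13) ↦ the locality hypotheses `hab`, `hbb`
  w.r.t. the cube adjacency (`cubeAdj`, `|j − j'| ≤ 1`), exactly as in `B4RandomWalk213`;
* the norms `‖·‖_∞, ‖·‖_{p₁}, ‖·‖_{p₁/2}, …, ‖·‖_{p₁/n₀} = ‖·‖₂` of (2.20)–(2.21) ↦ an ℕ-indexed family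
  `nrm : ℕ → E → ℝ`, level `i` standing for the exponent `1/p = i/p₁ = i/(2n₀)` (`nrm 0` ↦ `‖·‖_∞`, `nrm n₀` ↦ `‖·‖₂`);
  an operator bound `‖T‖_{q,p} ≤ β` ↦ `∀ g, nrm (level q) (T • g) ≤ β * nrm (level p) g`; the exponent arithmetic
  that makes each requested pair `(q, p)` admissible for (2.17) is §1 (`adm217_step`, `chain_top`, `chain_range`,
  `p1_choice`);
* "`□_{ω_i}` is a cube contained in `Ω`" (where Lemma 2.2 applies) ↦ a predicate `good : ι → Prop`; the graded
  bounds (2.17) are assumed for good labels only (`hgr`, `h0`), the `L²` bound (2.15) of Lemma 2.1 for all (`h2`);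
  the rôle of `R₀` (2.19) ↦ the hypothesis that labels met at printed positions `≤ n₀` of a walk from `S₀` are good
  (`hgood`; in the `ℤ^d` model derived from `hR₀ : sup-distance ≤ n₀ from S₀ ⇒ good` by `prefix_displacement`,
  and `reach_219` is the metric fact that turns `dist({x,x'},Ω^c) ≥ R₀` into it);
* "the left hand side of (1.9)" (resp. (1.10)) as a function of the vector `G_k(Ω,A)f` ↦ a subadditive,
  continuous functional `Φ : E → ℝ` with `Φ 0 ≤ 0` (a seminorm composed with evaluation at `x, x'`), vanishing after
  `a i` for `i ∉ S₀` (`x, x' ∉ supp h_i`) and bounded by `c₁‖·‖_∞` after `a i`, `i ∈ S₀` ((2.16): the `2^d` cubes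
  containing `x, x'` are interior); `supp f ⊂ □_{ω_n}` ↦ `a i • f = 0`, `b i • f = 0` for `i ∉ S₁`; the silent
  step `‖f‖₂ ≤ ‖f‖_∞` between the two sides of (2.21) ↦ `h2inf : nrm n₀ f ≤ V * nrm 0 f` with `V ≥ 1` carried
  into the constant (`V = 1` for `supp f` of weighted volume `≤ 1`, `l2_le_sup`; in general `V² = vol(supp f)`);
* `2^d(3^d)^{n−1}2^d` paths, `n ≥ M^{−1}dist − 2`, `3^dc₂O(1)M^{−1} ≤ e^{−1}` ↦ `|S₀|·Dⁿ` walks (`card_walks_le`,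
  `D = 3^d` by `card_cubeAdj_le`), `hsep`/`le_length_of_separated`, `hDβ`; the right cut-off `2^d` is not used
  (as in print, it only lowers the constant).

## What is proved

* §1 `adm217_step`, `chain_top`, `chain_range`, `p1_choice`: every pair `(q,p) = (p₁/(i−1), p₁/i)`, `1 ≤ i ≤ n₀`,
  and `(∞,∞)` satisfies the condition of (2.17); with `1/p₁ = 1/(2n₀)` the chain runs from `L²` (`i = n₀`) to
  `L^∞` (`i = 1`) through exponents in `[2, ∞]`; `n₀ = d` gives `p₁ = 2d > d + 1 > d` for `d ≥ 2`.  `l2_le_sup`: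
  `‖f‖₂ ≤ ‖f‖_∞` on weighted volume `≤ 1`.  `tail_222`: `x ≤ e^{−1}`, `N ≥ r − 2` ⇒ `x^N/(1−x) ≤ 2e²e^{−r}`.
* §2 `chain_bound_from` / `chain_bound_221` ((2.21)) / `chain_bound_220` ((2.20)) / `walk_vec_bound`: along one
  walk the graded one-step bounds compose to `‖(b_{ω₁}⋯b_{ω_n})f‖_∞ ≤ βⁿ‖f‖₂ ≤ βⁿV‖f‖_∞`, in BOTH regimes
  `n ≤ n₀`, `n > n₀`, using the interior (graded) bounds only at positions `≤ n₀`.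
* §3 `lp_walk_bound` ((2.18) ⇒ (2.22), abstract): `Φ(G • f) ≤ |S₀|·c₁·V·(Dβ)^N/(1 − Dβ)·‖f‖_∞`, the series
  being summed through `HasSum` + continuity of `Φ` (so *"We do not know yet if the series … is convergent"* is
  discharged by the majorant); `lp_walk_bound_exp`: with `Dβ ≤ e^{−1}`, `N ≥ r − 2`, `≤ 2|S₀|c₁Ve²e^{−r}‖f‖_∞`.
* §4 `lattice_lp_walk_bound`: the `ℤ^d` model with the printed cube adjacency, `D = 3^d`, separation by
  sup-distance, and `R₀` as "labels within `n₀` of `S₀` are good"; `reach_219`: the triangle inequality behind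
  (2.19) (`|y − x| ≤ M(t + 2)` for `y` in the cube of a label `t` steps from `ω₀`, `x ∈ □_{ω₀}`).

## What this file does NOT prove

Lemma 2.1 (2.15), Lemma 2.2 (2.16)–(2.17), the convergence (2.12), the identity (2.13) for the actual operators
(only its algebraic skeleton, imported from `B4RandomWalk213`), the bounds `‖K_j …‖ ≤ c₂O(1)M^{−1}` (the size
of `∂h_j`), or any statement about `G_k(Ω,A)`; the `δG_k` variant ((1.11)–(1.12), p.579) is the subject of
`B4RandomWalkDelta112` (single-norm form) and is not re-done with the chain here. Nor (records-only notes R1–R3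
of the cross-read, cell record C-adv2-45): the printed reduction *"hence we can assume |x' − x| ≤ 1"* (p.578)
behind the count `2^d` of initial cubes — `|S₀|` is a free parameter of §3–§4 (R1); the value of `V` for the
printed data `supp f ⊂ □_{ω_n}` (a cube of size `2M`: `V²` = its weighted volume, absorbed into `c₀`, which
depends on `M`, in print) — here the binder `hV` (R2); the conversion of the point distance
`dist({x,x'}, supp f)` into the label-level separation `hsep`/`hN` — a consumer hypothesis;
`le_length_of_separated` supplies it from a sup-distance separation of LABEL sets only (R3).  Value = kernel
certificate of the printed bookkeeping "Theorem ⇐ Lemma 2.1 + Lemma 2.2 + (2.13)", NOT progress on any summit.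

Version log: v1 — 2026-08-19, planner-b2b-balaban-b04-g9-0 (p182173). v1.1 (this file) — 2026-08-19, same seat:
DOCSTRING-ONLY — the printed exponent of (2.22) is now quoted as printed, `dist({x,x},supp f)`, with a ⟦sic⟧ mark
(v1 silently wrote `{x,x'}`; self-found by a scripted verbatim check, cell record GAPS E-b04g9-2, item N0) — also in
the docstring of `lp_walk_bound_exp`; the p.578 sentence *"We do not know yet if the series …"* is quoted with its
printed capital; and the three records-only notes R1–R3 of the cross-read XREAD C-adv2-45 (b2b-balaban-adv2-g31,
verdict ok, objections 0, no DOCFIX owed) are folded into "What this file does NOT prove". Every declaration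
(names, signatures, proofs) is byte-identical to v1.
-/

namespace Literature.MathematicalPhysics.QuantumFieldTheory.Balaban1983to89.B4LpChain221

open Finset Filter Topology
open Literature.MathematicalPhysics.QuantumFieldTheory.Balaban1983to89.B4RandomWalk213
open Literature.MathematicalPhysics.QuantumFieldTheory.Balaban1983to89.B4RandomWalkDelta112

/-! ### §1 The exponents requested from Lemma 2.2 by (2.20)–(2.21); two elementary inequalities -/

section Exponents

/-- Lemma 2.2's condition on the pair `(q, p)` in (2.17) reads, in RECIPROCAL exponents `s = 1/p`, `t = 1/q`,
`r = 1/p₁`: *"1/p − 1/p₁ ≤ 1/q ≤ 1/p"*, i.e. `s − r ≤ t ∧ t ≤ s`.  The diagonal `q = p` is admissible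
(`1/p₁ ≥ 0`): the pairs `(∞, ∞)` of (2.20) and `(2, 2)`. [cite: Balaban1983RegularityDecay, Lemma 2.2 (2.17),
(2.20) p.578] -/
theorem adm217_diag {r : ℝ} (hr : 0 ≤ r) (s : ℝ) : s - r ≤ s ∧ s ≤ s :=
  ⟨by linarith, le_rfl⟩

/-- **STEP `i` OF THE CHAIN (2.21)**: the pair `(q, p) = (p₁/(i−1), p₁/i)`, i.e. `(1/q, 1/p) = ((i−1)/p₁, i/p₁)`,
is admissible for (2.17) — `1/p − 1/p₁ = (i−1)/p₁ = 1/q ≤ 1/p` (for `i = 1` this is the pair `(∞, p₁)`):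
with `s = i·r`, `t = (i−1)·r`, `r = 1/p₁ ≥ 0`: `s − r ≤ t ∧ t ≤ s`. [cite: Balaban1983RegularityDecay, (2.17),
(2.21) p.578] -/
theorem adm217_step {r : ℝ} (hr : 0 ≤ r) (i : ℕ) (hi : 1 ≤ i) :
    (i : ℝ) * r - r ≤ (((i - 1 : ℕ) : ℝ) * r) ∧ ((i - 1 : ℕ) : ℝ) * r ≤ (i : ℝ) * r := by
  have h : ((i - 1 : ℕ) : ℝ) = (i : ℝ) - 1 := by
    rw [Nat.cast_sub hi, Nat.cast_one]
  refine ⟨?_, ?_⟩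
  · rw [h]; nlinarith
  · rw [h]; nlinarith

/-- the chain starts at `L²`: *"we apply (2.17) with 1/p₁ = 1/(2n₀)"*, so after `n₀` steps the exponent is
`n₀/p₁ = 1/2`, i.e. step `i = n₀` is `‖·‖_{p₁/(n₀−1), 2}` and the factors `i > n₀` are `‖·‖_{2,2}`.
[cite: Balaban1983RegularityDecay, (2.21) p.578] -/
theorem chain_top (n₀ : ℕ) (h : 0 < n₀) : (n₀ : ℝ) * (1 / (2 * (n₀ : ℝ))) = 1 / 2 := by
  have : (n₀ : ℝ) ≠ 0 := by exact_mod_cast h.ne'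
  field_simp

/-- every exponent `i/p₁`, `0 ≤ i ≤ n₀`, of the chain lies in `[0, 1/2]`, i.e. `2 ≤ p ≤ ∞` — inside the range
*"1 ≤ p, q ≤ ∞"* of (2.17). [cite: Balaban1983RegularityDecay, (2.17), (2.21) p.578] -/
theorem chain_range (n₀ i : ℕ) (h : 0 < n₀) (hi : i ≤ n₀) :
    0 ≤ (i : ℝ) * (1 / (2 * (n₀ : ℝ))) ∧ (i : ℝ) * (1 / (2 * (n₀ : ℝ))) ≤ 1 / 2 := by
  have hn : (0 : ℝ) < n₀ := by exact_mod_cast h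
  have hi' : (i : ℝ) ≤ n₀ := by exact_mod_cast hi
  refine ⟨by positivity, ?_⟩
  rw [← chain_top n₀ h]
  exact mul_le_mul_of_nonneg_right hi' (by positivity)

/-- *"we fix n₀ such that p₁ = 2n₀ > d + 1, e.g. n₀ = d"*: with `n₀ = d`, `p₁ = 2d > d + 1` holds iff `d ≥ 2`,
and then also Lemma 2.2's *"with p₁ > d"*. [cite: Balaban1983RegularityDecay, (2.21) p.578, Lemma 2.2 p.578] -/
theorem p1_choice (d : ℕ) (hd : 2 ≤ d) : (d : ℝ) + 1 < 2 * (d : ℝ) ∧ (d : ℝ) < 2 * (d : ℝ) := by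
  have hd' : (2 : ℝ) ≤ d := by exact_mod_cast hd
  constructor <;> linarith

/-- `‖f‖₂ ≤ ‖f‖_∞` for `f` supported in a set of weighted volume `≤ 1` (a unit cube of the `η`-lattice: weight
`η^d` on `η^{−d}` sites) — the last step *"‖f‖₂ ≤ … ‖f‖_∞"* of (2.21). [cite: Balaban1983RegularityDecay,
(2.21) p.578] -/
theorem l2_le_sup {X : Type*} (S : Finset X) (w C : ℝ) (f : X → ℝ) (hw : 0 ≤ w) (hC : 0 ≤ C)
    (hvol : w * S.card ≤ 1) (hf : ∀ x ∈ S, |f x| ≤ C) :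
    Real.sqrt (∑ x ∈ S, w * f x ^ 2) ≤ C := by
  have h1 : ∑ x ∈ S, w * f x ^ 2 ≤ ∑ _x ∈ S, w * C ^ 2 := by
    refine Finset.sum_le_sum fun x hx => mul_le_mul_of_nonneg_left ?_ hw
    rw [← sq_abs]
    exact pow_le_pow_left₀ (abs_nonneg _) (hf x hx) 2
  have h2 : ∑ _x ∈ S, w * C ^ 2 = (w * S.card) * C ^ 2 := by
    rw [Finset.sum_const, nsmul_eq_mul]; ring
  have h3 : ∑ x ∈ S, w * f x ^ 2 ≤ C ^ 2 := by
    rw [h2] at h1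
    exact h1.trans (mul_le_of_le_one_left (sq_nonneg C) hvol)
  calc Real.sqrt (∑ x ∈ S, w * f x ^ 2) ≤ Real.sqrt (C ^ 2) := Real.sqrt_le_sqrt h3
    _ = C := Real.sqrt_sq hC

/-- **THE TAIL OF (2.22)**: if the ratio `x = 3^dc₂O(1)M^{−1}` satisfies *"3^dc₂O(1)M^{−1} ≤ e^{−1}"* and the
walks have length `N ≥ r − 2` (*"n ≥ M^{−1}dist({x,x'}, supp f) − 2"*, `r = M^{−1}dist`), then
`Σ_{n≥N} xⁿ = x^N/(1 − x) ≤ 2e²·e^{−r}`.  (The printed prefactor reads `2^{d+1}/e²`; the tail gives `e^{+2}` —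
a misprint absorbed in `c₀`.) [cite: Balaban1983RegularityDecay, (2.22) p.579] -/
theorem tail_222 {x r : ℝ} {N : ℕ} (hx0 : 0 ≤ x) (hx : x ≤ Real.exp (-1)) (hN : r - 2 ≤ N) :
    x ^ N / (1 - x) ≤ 2 * Real.exp 2 * Real.exp (-r) := by
  have he2 : (2 : ℝ) ≤ Real.exp 1 := by
    have h := Real.add_one_le_exp (1 : ℝ)
    norm_num at h
    exact h
  have he : Real.exp (-1) ≤ 1 / 2 := by
    rw [Real.exp_neg, inv_eq_one_div]
    exact one_div_le_one_div_of_le (by norm_num) he2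
  have h1x : 1 / 2 ≤ 1 - x := by linarith
  have hpow : x ^ N ≤ Real.exp 2 * Real.exp (-r) := by
    calc x ^ N ≤ (Real.exp (-1)) ^ N := pow_le_pow_left₀ hx0 hx N
      _ = Real.exp ((N : ℝ) * (-1)) := (Real.exp_nat_mul (-1) N).symm
      _ ≤ Real.exp (-(r - 2)) := Real.exp_le_exp.mpr (by linarith)
      _ = Real.exp 2 * Real.exp (-r) := by rw [← Real.exp_add]; ring_nf
  have hE : 0 ≤ Real.exp 2 * Real.exp (-r) := by positivity
  have hmul := mul_le_mul_of_nonneg_left h1x hE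
  rw [div_le_iff₀ (by linarith)]
  linarith

/-- **THE GEOMETRY OF (2.19)**: if `x` lies in the cube of label `ω₀` (`|x − Mω₀| ≤ M` coordinatewise), the label
`ω_t` is `≤ t` label-steps from `ω₀`, and `y` lies in the cube of `ω_t` (*"□_j denotes a cube with center Mj and
size equal to 2M"*), then `|y − x| ≤ M(t + 2)`: every cube met in the first `n₀` steps lies within `M(n₀ + 2) ≤ R₀`
of `x`, hence inside `Ω` when `dist(x, Ω^c) ≥ R₀` — *"the definition (2.19) of R₀ impl[ies] that all □_{ω_i} are
cubes contained in Ω"*. [cite: Balaban1983RegularityDecay, (2.19) p.578] -/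
theorem reach_219 {M x y c₀ c t : ℝ} (hM : 0 ≤ M) (hx : |x - M * c₀| ≤ M) (hc : |c₀ - c| ≤ t)
    (hy : |y - M * c| ≤ M) : |y - x| ≤ M * (t + 2) := by
  have h1 : |M * c - M * c₀| ≤ M * t := by
    rw [← mul_sub, abs_mul, abs_of_nonneg hM, abs_sub_comm]
    exact mul_le_mul_of_nonneg_left hc hM
  have h2 : |M * c₀ - x| ≤ M := by rw [abs_sub_comm]; exact hx
  calc |y - x| ≤ |y - M * c| + |M * c - x| := abs_sub_le _ _ _
    _ ≤ |y - M * c| + (|M * c - M * c₀| + |M * c₀ - x|) := add_le_add le_rfl (abs_sub_le _ _ _)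
    _ ≤ M + (M * t + M) := add_le_add hy (add_le_add h1 h2)
    _ = M * (t + 2) := by ring

end Exponents

/-! ### §2 The graded chain of one-step bounds along one walk: (2.20) and (2.21) -/

section Chain

variable {R : Type*} [Ring R] {E : Type*} [AddCommGroup E] [Module R E] {ι : Type*}

/-- **THE CHAIN (2.21), GENERAL POSITION.**  Levels `0, 1, …, n₀` stand for the exponents `1/p = 0, 1/p₁, …,
n₀/p₁ = 1/2` (`nrm i` ↦ `‖·‖_{p₁/i}`, `nrm 0` ↦ `‖·‖_∞`, `nrm n₀` ↦ `‖·‖₂`).  Suppose every GOOD label `j`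
(↦ an interior cube, where Lemma 2.2 applies) satisfies the graded bound `nrm (i−1) (b j • g) ≤ β · nrm i g` for
`1 ≤ i ≤ n₀` (↦ `‖K_jG_k(□_j,Ã_j)h_j‖_{p₁/(i−1), p₁/i} ≤ c₂O(1)M^{−1}`, by (2.17)), and EVERY label the level-`n₀`
bound `nrm n₀ (b j • g) ≤ β · nrm n₀ g` (↦ the `‖·‖_{2,2}` bound from Lemma 2.1, valid for boundary cubes).  Then
for a tuple `ys` of length `m` occupying printed positions `k + 1, …, k + m`, whose entries at positions `≤ n₀`
are good, `nrm (min k n₀) (b ys₀ ⋯ b ys_{m−1} • f) ≤ β^m · nrm (min (k + m) n₀) f`.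
[cite: Balaban1983RegularityDecay, (2.21) p.578] -/
theorem chain_bound_from {nrm : ℕ → E → ℝ} {b : ι → R} {good : ι → Prop} {β : ℝ} {n₀ : ℕ} (hβ : 0 ≤ β)
    (hgr : ∀ j, good j → ∀ i, 1 ≤ i → i ≤ n₀ → ∀ g : E, nrm (i - 1) (b j • g) ≤ β * nrm i g)
    (h2 : ∀ (j) (g : E), nrm n₀ (b j • g) ≤ β * nrm n₀ g) :
    ∀ (m k : ℕ) (ys : Fin m → ι) (f : E), (∀ t : Fin m, k + t + 1 ≤ n₀ → good (ys t)) →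
      nrm (min k n₀) (bprod b m ys • f) ≤ β ^ m * nrm (min (k + m) n₀) f := by
  intro m
  induction m with
  | zero =>
      intro k ys f _
      simp only [bprod_zero, one_smul, pow_zero, one_mul, Nat.add_zero, le_refl]
  | succ m ih =>
      intro k ys f hgood
      have htail : ∀ t : Fin m, (k + 1) + t + 1 ≤ n₀ → good (Fin.tail ys t) := fun t ht =>
        hgood t.succ (by rw [Fin.val_succ]; omega)
      have ih' := ih (k + 1) (Fin.tail ys) f htail
      rw [show k + 1 + m = k + (m + 1) by omega] at ih'
      set g := bprod b m (Fin.tail ys) • f with hg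
      have hfac : nrm (min k n₀) (b (ys 0) • g) ≤ β * nrm (min (k + 1) n₀) g := by
        by_cases hk : k + 1 ≤ n₀
        · have e1 : min k n₀ = k := Nat.min_eq_left (by omega)
          have e2 : min (k + 1) n₀ = k + 1 := Nat.min_eq_left hk
          have h := hgr (ys 0) (hgood 0 (by simp; omega)) (k + 1) (by omega) hk g
          rw [Nat.add_sub_cancel] at h
          rw [e1, e2]
          exact h
        · have e1 : min k n₀ = n₀ := Nat.min_eq_right (by omega)
          have e2 : min (k + 1) n₀ = n₀ := Nat.min_eq_right (by omega)
          rw [e1, e2]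
          exact h2 _ _
      rw [bprod_succ, mul_smul]
      calc nrm (min k n₀) (b (ys 0) • g) ≤ β * nrm (min (k + 1) n₀) g := hfac
        _ ≤ β * (β ^ m * nrm (min (k + (m + 1)) n₀) f) := mul_le_mul_of_nonneg_left ih' hβ
        _ = β ^ (m + 1) * nrm (min (k + (m + 1)) n₀) f := by ring

/-- **(2.21)**: a walk of length `n ≥ n₀` whose labels at positions `≤ n₀` are good maps `L²` into `L^∞` at the
cost `βⁿ`: `‖K_{ω₁}⋯‖_{∞,p₁} Π_{i=2}^{n₀}‖⋯‖_{p₁/(i−1),p₁/i} Π_{i>n₀}‖⋯‖_{2,2}‖f‖₂ ≤ (c₂O(1)M^{−1})ⁿ‖f‖₂`.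
[cite: Balaban1983RegularityDecay, (2.21) p.578] -/
theorem chain_bound_221 {nrm : ℕ → E → ℝ} {b : ι → R} {good : ι → Prop} {β : ℝ} {n₀ : ℕ} (hβ : 0 ≤ β)
    (hgr : ∀ j, good j → ∀ i, 1 ≤ i → i ≤ n₀ → ∀ g : E, nrm (i - 1) (b j • g) ≤ β * nrm i g)
    (h2 : ∀ (j) (g : E), nrm n₀ (b j • g) ≤ β * nrm n₀ g)
    {n : ℕ} (hn : n₀ ≤ n) (ys : Fin n → ι) (f : E) (hgood : ∀ t : Fin n, (t : ℕ) + 1 ≤ n₀ → good (ys t)) :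
    nrm 0 (bprod b n ys • f) ≤ β ^ n * nrm n₀ f := by
  have h := chain_bound_from hβ hgr h2 n 0 ys f (fun t ht => hgood t (by omega))
  rwa [Nat.zero_min, Nat.zero_add, Nat.min_eq_right hn] at h

/-- the same chain for a SHORT walk (`n ≤ n₀`, all labels good) ends at `‖f‖_{p₁/n}`: `nrm 0 (⋯ • f) ≤ βⁿ · nrm n f`
(a valid alternative to (2.20) for the first subsum). [cite: Balaban1983RegularityDecay, (2.20)–(2.21) p.578] -/
theorem chain_bound_short {nrm : ℕ → E → ℝ} {b : ι → R} {good : ι → Prop} {β : ℝ} {n₀ : ℕ} (hβ : 0 ≤ β)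
    (hgr : ∀ j, good j → ∀ i, 1 ≤ i → i ≤ n₀ → ∀ g : E, nrm (i - 1) (b j • g) ≤ β * nrm i g)
    (h2 : ∀ (j) (g : E), nrm n₀ (b j • g) ≤ β * nrm n₀ g)
    {n : ℕ} (hn : n ≤ n₀) (ys : Fin n → ι) (f : E) (hgood : ∀ t : Fin n, good (ys t)) :
    nrm 0 (bprod b n ys • f) ≤ β ^ n * nrm n f := by
  have h := chain_bound_from hβ hgr h2 n 0 ys f (fun t _ => hgood t)
  rwa [Nat.zero_min, Nat.zero_add, Nat.min_eq_left hn] at h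

/-- **(2.20)**: a walk all of whose labels are good maps `L^∞` to `L^∞` at the cost `βⁿ`, using the pair
`(q, p) = (∞, ∞)` of (2.17) at every step: `‖K_{ω₁}⋯‖_∞ ⋯ ‖K_{ω_n}⋯‖_∞‖f‖_∞ ≤ (c₂O(1)M^{−1})ⁿ‖f‖_∞`.
[cite: Balaban1983RegularityDecay, (2.20) p.578] -/
theorem chain_bound_220 {nrm : ℕ → E → ℝ} {b : ι → R} {good : ι → Prop} {β : ℝ} (hβ : 0 ≤ β)
    (h0 : ∀ j, good j → ∀ g : E, nrm 0 (b j • g) ≤ β * nrm 0 g) :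
    ∀ (n : ℕ) (ys : Fin n → ι) (f : E), (∀ t : Fin n, good (ys t)) →
      nrm 0 (bprod b n ys • f) ≤ β ^ n * nrm 0 f := by
  intro n
  induction n with
  | zero => intro ys f _; simp
  | succ n ih =>
      intro ys f hgood
      rw [bprod_succ, mul_smul, pow_succ', mul_assoc]
      exact (h0 _ (hgood 0) _).trans
        (mul_le_mul_of_nonneg_left (ih (Fin.tail ys) f fun t => hgood t.succ) hβ)

/-- **ONE WALK OF (2.18), BOTH REGIMES**: if the labels at printed positions `≤ n₀` are good (the rôle of `R₀`,
(2.19)) and `‖f‖₂ ≤ V‖f‖_∞` (`V ≥ 1`: `V = 1` for `supp f` in a unit cube, `l2_le_sup`; in general `V² =` the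
weighted volume of `supp f`), then `nrm 0 (b ys₀ ⋯ • f) ≤ βⁿ · V‖f‖_∞` — by (2.20) for `n ≤ n₀` and by (2.21) for
`n > n₀`. [cite: Balaban1983RegularityDecay, (2.20)–(2.21) p.578] -/
theorem walk_vec_bound {nrm : ℕ → E → ℝ} {b : ι → R} {good : ι → Prop} {β : ℝ} {n₀ : ℕ} (hβ : 0 ≤ β)
    (hgr : ∀ j, good j → ∀ i, 1 ≤ i → i ≤ n₀ → ∀ g : E, nrm (i - 1) (b j • g) ≤ β * nrm i g)
    (h2 : ∀ (j) (g : E), nrm n₀ (b j • g) ≤ β * nrm n₀ g)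
    (h0 : ∀ j, good j → ∀ g : E, nrm 0 (b j • g) ≤ β * nrm 0 g)
    {f : E} {V : ℝ} (hV : 1 ≤ V) (h2inf : nrm n₀ f ≤ V * nrm 0 f) (hnrm : 0 ≤ nrm 0 f)
    (n : ℕ) (ys : Fin n → ι) (hgood : ∀ t : Fin n, (t : ℕ) + 1 ≤ n₀ → good (ys t)) :
    nrm 0 (bprod b n ys • f) ≤ β ^ n * (V * nrm 0 f) := by
  by_cases hn : n ≤ n₀
  · exact (chain_bound_220 hβ h0 n ys f fun t => hgood t (by omega)).trans
      (mul_le_mul_of_nonneg_left (le_mul_of_one_le_left hnrm hV) (pow_nonneg hβ n))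
  · exact (chain_bound_221 hβ hgr h2 (by omega) ys f hgood).trans
      (mul_le_mul_of_nonneg_left h2inf (pow_nonneg hβ n))

/-- **RIGHT CUT-OFF, VECTOR FORM**: if the last factor kills `f` (`b ω_n • f = 0`: `supp f` off `supp h_{ω_n}`),
the whole walk term applied to `f` vanishes. [cite: Balaban1983RegularityDecay, p.578 "supp f ⊂ □_{ω_n}"] -/
theorem bprod_smul_eq_zero_of_last (b : ι → R) {f : E} :
    ∀ (n : ℕ) (ys : Fin (n + 1) → ι), b (ys (Fin.last n)) • f = 0 → bprod b (n + 1) ys • f = 0 := by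
  intro n
  induction n with
  | zero =>
      intro ys h
      have h' : b (ys 0) • f = 0 := by simpa using h
      rw [bprod_one, h']
  | succ n ih =>
      intro ys h
      rw [bprod_succ, mul_smul, ih (Fin.tail ys) (by simpa [Fin.tail, Fin.succ_last] using h), smul_zero]

end Chain

/-! ### §3 (2.18) ⇒ (2.22): the walk bounds summed through the convergent expansion (2.12)/(2.13) -/

section Terms

variable {R : Type*} [Ring R] {E : Type*} [AddCommGroup E] [Module R E] {ι : Type*}

/-- the order-`n` vector of (2.13) applied to `f`: `(G₀Rⁿ) • f = Σ_{ω₀} Σ_{walks} (a ω₀ * b ω₁ ⋯ b ω_n) • f`.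
[cite: Balaban1983RegularityDecay, (2.13) p.577, (2.18) p.578] -/
theorem order_vec_eq_sum_walks [Fintype ι] (adj : ι → ι → Prop) [DecidableRel adj] {a b : ι → R}
    (hab : ∀ i l, ¬ adj i l → a i * b l = 0) (hbb : ∀ i l, ¬ adj i l → b i * b l = 0) (f : E) (n : ℕ) :
    ((∑ i, a i) * (∑ i, b i) ^ n) • f = ∑ i, ∑ ys ∈ walks adj i n, (a i * bprod b n ys) • f := by
  rw [order_term_eq_sum_walks adj hab hbb n, Finset.sum_smul]
  exact Finset.sum_congr rfl fun i _ => Finset.sum_smul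

/-- **ONE TERM OF (2.18)**: with the target functional `Φ` (↦ the left-hand side of (1.9)/(1.10) as a function
of the vector) `≤ 0` on `a i • g` for `i ∉ S₀` (`x, x'` off `supp h_i`), bounded by `c₁‖g‖_∞` for `i ∈ S₀`
((2.16)), and `f` killed by `a i`, `b i` off `S₁`: the walk term `(ω₀, ys)` contributes `Φ ≤ c₁βⁿ‖f‖_∞` if
`n ≥ N`, and `Φ ≤ 0` if `n < N` (then no walk from `S₀` ends in `S₁`). [cite: Balaban1983RegularityDecay,
(2.18), (2.20)–(2.21) p.578; p.579 "n ≥ M^{−1}dist({x,x'}, supp f) − 2"] -/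
theorem walk_term_bound (adj : ι → ι → Prop) {a b : ι → R} {f : E} {Φ : E → ℝ} {nrm : ℕ → E → ℝ}
    {good : ι → Prop} {S₀ S₁ : Finset ι} {c₁ β : ℝ} {n₀ N : ℕ}
    (hΦ0 : Φ 0 ≤ 0) (hS₀ : ∀ i ∉ S₀, ∀ g : E, Φ (a i • g) ≤ 0)
    (hS₁a : ∀ i ∉ S₁, a i • f = 0) (hS₁b : ∀ i ∉ S₁, b i • f = 0)
    (hc₁ : 0 ≤ c₁) (ha : ∀ i ∈ S₀, ∀ g : E, Φ (a i • g) ≤ c₁ * nrm 0 g)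
    (hβ : 0 ≤ β)
    (hgr : ∀ j, good j → ∀ i, 1 ≤ i → i ≤ n₀ → ∀ g : E, nrm (i - 1) (b j • g) ≤ β * nrm i g)
    (h2 : ∀ (j) (g : E), nrm n₀ (b j • g) ≤ β * nrm n₀ g)
    (h0 : ∀ j, good j → ∀ g : E, nrm 0 (b j • g) ≤ β * nrm 0 g)
    {V : ℝ} (hV : 1 ≤ V) (h2inf : nrm n₀ f ≤ V * nrm 0 f) (hnrm : 0 ≤ nrm 0 f)
    (hgood : ∀ (n : ℕ) (i : ι), i ∈ S₀ → ∀ ys : Fin n → ι, IsWalk adj i ys →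
      ∀ t : Fin n, (t : ℕ) + 1 ≤ n₀ → good (ys t))
    (hsep : ∀ (n : ℕ) (i : ι), i ∈ S₀ → ∀ ys : Fin n → ι, IsWalk adj i ys → lastPt i n ys ∈ S₁ → N ≤ n)
    (n : ℕ) (i : ι) (ys : Fin n → ι) (hw : IsWalk adj i ys) :
    Φ ((a i * bprod b n ys) • f) ≤ if N ≤ n then c₁ * β ^ n * (V * nrm 0 f) else 0 := by
  have hpos : 0 ≤ c₁ * β ^ n * (V * nrm 0 f) :=
    mul_nonneg (mul_nonneg hc₁ (pow_nonneg hβ n)) (mul_nonneg (zero_le_one.trans hV) hnrm)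
  by_cases hi : i ∈ S₀
  · by_cases hl : lastPt i n ys ∈ S₁
    · have hNn : N ≤ n := hsep n i hi ys hw hl
      rw [if_pos hNn, mul_smul]
      exact (ha i hi _).trans (by
        rw [mul_assoc]
        exact mul_le_mul_of_nonneg_left
          (walk_vec_bound hβ hgr h2 h0 hV h2inf hnrm n ys (hgood n i hi ys hw)) hc₁)
    · have hz : (a i * bprod b n ys) • f = 0 := by
        cases n with
        | zero =>
            rw [lastPt_zero] at hl
            rw [bprod_zero, mul_one, hS₁a i hl]
        | succ m =>
            rw [mul_smul, bprod_smul_eq_zero_of_last b m ys (hS₁b _ hl), smul_zero]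
      rw [hz]
      exact hΦ0.trans (by split_ifs <;> simp [hpos])
  · rw [mul_smul]
    exact (hS₀ i hi _).trans (by split_ifs <;> simp [hpos])

end Terms

section Series

variable {R : Type*} [Ring R] [TopologicalSpace R] {E : Type*} [AddCommGroup E] [Module R E]
  [TopologicalSpace E] [ContinuousSMul R E] {ι : Type*} [Fintype ι] [DecidableEq ι]

/-- **(2.18)–(2.22), ABSTRACT FORM.**  Let `G = Σ_n G₀Rⁿ` ((2.12), a convergent series in a topological ring
acting continuously on the vectors), `G₀ = Σ_j a j`, `R = Σ_j b j` with LOCAL factors ((2.13)); let the target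
functional `Φ` be subadditive, continuous, `Φ 0 ≤ 0`, `≤ 0` on `a i • g` off `S₀`, and `≤ c₁‖·‖_∞` after `a i`,
`i ∈ S₀` ((2.16)); let `f` be killed by the factors off `S₁`, with `‖f‖₂ ≤ V‖f‖_∞`; assume the graded bounds of
Lemma 2.2 for good labels and the `L²` bound of Lemma 2.1 for all labels ((2.17), (2.15), each `≤ β`), that
walks from `S₀` meet only good labels at positions `≤ n₀` ((2.19)), out-degree `≤ D`, `Dβ < 1`, and that a walk
from `S₀` ending in `S₁` has `≥ N` steps.  Then `Φ(G • f) ≤ |S₀|·c₁·V·(Dβ)^N/(1 − Dβ)·‖f‖_∞`: the series of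
(2.18) converges and is bounded by *"Σ_n 2^d c₁(3^d c₂O(1)M^{−1})ⁿ‖f‖_∞"* over `n ≥ N`.
[cite: Balaban1983RegularityDecay, (2.18) p.578, (2.22) p.579] -/
theorem lp_walk_bound (adj : ι → ι → Prop) [DecidableRel adj]
    {a b : ι → R} {G G₀ Rop : R} {f : E} {Φ : E → ℝ} {nrm : ℕ → E → ℝ} {good : ι → Prop}
    {S₀ S₁ : Finset ι} {c₁ β : ℝ} {D N n₀ : ℕ}
    (hG₀ : G₀ = ∑ i, a i) (hRop : Rop = ∑ i, b i) (hG : HasSum (fun n : ℕ => G₀ * Rop ^ n) G)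
    (hab : ∀ i l, ¬ adj i l → a i * b l = 0) (hbb : ∀ i l, ¬ adj i l → b i * b l = 0)
    (hΦ0 : Φ 0 ≤ 0) (hΦadd : ∀ x y, Φ (x + y) ≤ Φ x + Φ y) (hΦc : Continuous Φ)
    (hS₀ : ∀ i ∉ S₀, ∀ g : E, Φ (a i • g) ≤ 0)
    (hS₁a : ∀ i ∉ S₁, a i • f = 0) (hS₁b : ∀ i ∉ S₁, b i • f = 0)
    (hc₁ : 0 ≤ c₁) (ha : ∀ i ∈ S₀, ∀ g : E, Φ (a i • g) ≤ c₁ * nrm 0 g)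
    (hβ : 0 ≤ β)
    (hgr : ∀ j, good j → ∀ i, 1 ≤ i → i ≤ n₀ → ∀ g : E, nrm (i - 1) (b j • g) ≤ β * nrm i g)
    (h2 : ∀ (j) (g : E), nrm n₀ (b j • g) ≤ β * nrm n₀ g)
    (h0 : ∀ j, good j → ∀ g : E, nrm 0 (b j • g) ≤ β * nrm 0 g)
    {V : ℝ} (hV : 1 ≤ V) (h2inf : nrm n₀ f ≤ V * nrm 0 f) (hnrm : 0 ≤ nrm 0 f)
    (hgood : ∀ (n : ℕ) (i : ι), i ∈ S₀ → ∀ ys : Fin n → ι, IsWalk adj i ys →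
      ∀ t : Fin n, (t : ℕ) + 1 ≤ n₀ → good (ys t))
    (hD : ∀ j, (Finset.univ.filter fun i => adj j i).card ≤ D) (hDβ : (D : ℝ) * β < 1)
    (hsep : ∀ (n : ℕ) (i : ι), i ∈ S₀ → ∀ ys : Fin n → ι, IsWalk adj i ys → lastPt i n ys ∈ S₁ → N ≤ n) :
    Φ (G • f) ≤ S₀.card * c₁ * V * ((D : ℝ) * β) ^ N / (1 - D * β) * nrm 0 f := by
  subst hG₀ hRop
  -- the vector series (2.12)·f and its partial sums
  have hf : HasSum (fun n : ℕ => ((∑ i, a i) * (∑ i, b i) ^ n) • f) (G • f) := hG.smul_const f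
  have hlim : Tendsto (fun m : ℕ => ∑ n ∈ Finset.range m, ((∑ i, a i) * (∑ i, b i) ^ n) • f)
      atTop (𝓝 (G • f)) := hf.tendsto_sum_nat
  -- majorant of the order-n term: |S₀| Dⁿ c₁ βⁿ ‖f‖_∞ for n ≥ N, else 0
  have hVn : 0 ≤ V * nrm 0 f := mul_nonneg (zero_le_one.trans hV) hnrm
  set K : ℝ := S₀.card * c₁ * (V * nrm 0 f) with hK
  have hK0 : 0 ≤ K := mul_nonneg (mul_nonneg (Nat.cast_nonneg _) hc₁) hVn
  have hr0 : 0 ≤ (D : ℝ) * β := mul_nonneg (Nat.cast_nonneg _) hβ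
  have horder : ∀ n : ℕ, Φ (((∑ i, a i) * (∑ i, b i) ^ n) • f) ≤
      if N ≤ n then K * ((D : ℝ) * β) ^ n else 0 := fun n => by
    rw [order_vec_eq_sum_walks adj hab hbb f n]
    have hterm := walk_term_bound adj hΦ0 hS₀ hS₁a hS₁b hc₁ ha hβ hgr h2 h0 hV h2inf hnrm hgood hsep n
    calc Φ (∑ i, ∑ ys ∈ walks adj i n, (a i * bprod b n ys) • f)
        ≤ ∑ i, Φ (∑ ys ∈ walks adj i n, (a i * bprod b n ys) • f) :=
          Finset.le_sum_of_subadditive Φ hΦ0 hΦadd _ _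
      _ ≤ ∑ i, ∑ ys ∈ walks adj i n, Φ ((a i * bprod b n ys) • f) :=
          Finset.sum_le_sum fun i _ => Finset.le_sum_of_subadditive Φ hΦ0 hΦadd _ _
      _ ≤ ∑ i, ∑ ys ∈ walks adj i n,
            (if i ∈ S₀ then (if N ≤ n then c₁ * β ^ n * (V * nrm 0 f) else 0) else 0) := by
          refine Finset.sum_le_sum fun i _ => Finset.sum_le_sum fun ys hys => ?_
          by_cases hi : i ∈ S₀
          · rw [if_pos hi]; exact hterm i ys (mem_walks.mp hys)
          · rw [if_neg hi, mul_smul]; exact hS₀ i hi _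
      _ = ∑ i ∈ S₀, ∑ _ys ∈ walks adj i n, (if N ≤ n then c₁ * β ^ n * (V * nrm 0 f) else 0) := by
          rw [← Finset.sum_subset (Finset.subset_univ S₀) (fun i _ hi => by rw [if_neg hi]; simp)]
          exact Finset.sum_congr rfl fun i hi => by rw [if_pos hi]
      _ ≤ ∑ _i ∈ S₀, (D : ℝ) ^ n * (if N ≤ n then c₁ * β ^ n * (V * nrm 0 f) else 0) := by
          refine Finset.sum_le_sum fun i _ => ?_
          rw [Finset.sum_const, nsmul_eq_mul]
          refine mul_le_mul_of_nonneg_right (by exact_mod_cast card_walks_le adj hD n i) ?_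
          split_ifs
          · exact mul_nonneg (mul_nonneg hc₁ (pow_nonneg hβ n)) hVn
          · exact le_rfl
      _ = if N ≤ n then K * ((D : ℝ) * β) ^ n else 0 := by
          rw [Finset.sum_const, nsmul_eq_mul, hK]
          split_ifs
          · ring
          · simp
  -- the majorant series: Σ_{n ≥ N} K (Dβ)ⁿ = K (Dβ)^N / (1 − Dβ)
  have hgeo : HasSum (fun n : ℕ => if N ≤ n then K * ((D : ℝ) * β) ^ n else 0)
      (K * ((D : ℝ) * β) ^ N / (1 - D * β)) := by
    have h1 : HasSum (fun m : ℕ => K * ((D : ℝ) * β) ^ N * ((D : ℝ) * β) ^ m)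
        (K * ((D : ℝ) * β) ^ N * (1 - (D : ℝ) * β)⁻¹) :=
      (hasSum_geometric_of_lt_one hr0 hDβ).mul_left _
    refine (hasSum_nat_add_iff' N).mp ?_
    have hz : ∑ i ∈ Finset.range N, (if N ≤ i then K * ((D : ℝ) * β) ^ i else 0) = 0 :=
      Finset.sum_eq_zero fun i hi => by rw [if_neg (not_le.mpr (Finset.mem_range.mp hi))]
    rw [hz, sub_zero, div_eq_mul_inv]
    refine h1.congr_fun fun m => ?_
    show (if N ≤ m + N then K * ((D : ℝ) * β) ^ (m + N) else 0) = K * ((D : ℝ) * β) ^ N * ((D : ℝ) * β) ^ m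
    rw [if_pos (Nat.le_add_left N m), pow_add]
    ring
  -- partial sums are bounded by the full majorant
  have hpartial : ∀ m : ℕ, Φ (∑ n ∈ Finset.range m, ((∑ i, a i) * (∑ i, b i) ^ n) • f) ≤
      K * ((D : ℝ) * β) ^ N / (1 - D * β) := fun m =>
    calc Φ (∑ n ∈ Finset.range m, ((∑ i, a i) * (∑ i, b i) ^ n) • f)
        ≤ ∑ n ∈ Finset.range m, Φ (((∑ i, a i) * (∑ i, b i) ^ n) • f) :=
          Finset.le_sum_of_subadditive Φ hΦ0 hΦadd _ _
      _ ≤ ∑ n ∈ Finset.range m, (if N ≤ n then K * ((D : ℝ) * β) ^ n else 0) :=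
          Finset.sum_le_sum fun n _ => horder n
      _ ≤ K * ((D : ℝ) * β) ^ N / (1 - D * β) :=
          sum_le_hasSum _ (fun n _ => by split_ifs <;> [exact mul_nonneg hK0 (pow_nonneg hr0 n); exact le_rfl])
            hgeo
  -- pass to the limit through the continuity of Φ
  have hle := le_of_tendsto' ((hΦc.tendsto _).comp hlim) hpartial
  calc Φ (G • f) ≤ K * ((D : ℝ) * β) ^ N / (1 - D * β) := hle
    _ = S₀.card * c₁ * V * ((D : ℝ) * β) ^ N / (1 - D * β) * nrm 0 f := by rw [hK]; ring

/-- **(2.22), EXPONENTIAL FORM**: if moreover `Dβ ≤ e^{−1}` (*"M is fixed such that 3^dc₂O(1)M^{−1} ≤ e^{−1}"*)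
and `N ≥ r − 2` (*"n ≥ M^{−1}dist({x,x'}, supp f) − 2"*), then `Φ(G • f) ≤ 2|S₀|c₁Ve²·e^{−r}·‖f‖_∞` — the
printed `(2^{d+1}/e²)e^{−M^{−1}dist({x,x},supp f)}‖f‖_∞` (sic: `{x,x'}`) with `|S₀| = 2^d`, `V` absorbed, and the
tail constant corrected to `e^{+2}`.
[cite: Balaban1983RegularityDecay, (2.22) p.579] -/
theorem lp_walk_bound_exp (adj : ι → ι → Prop) [DecidableRel adj]
    {a b : ι → R} {G G₀ Rop : R} {f : E} {Φ : E → ℝ} {nrm : ℕ → E → ℝ} {good : ι → Prop}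
    {S₀ S₁ : Finset ι} {c₁ β r : ℝ} {D N n₀ : ℕ}
    (hG₀ : G₀ = ∑ i, a i) (hRop : Rop = ∑ i, b i) (hG : HasSum (fun n : ℕ => G₀ * Rop ^ n) G)
    (hab : ∀ i l, ¬ adj i l → a i * b l = 0) (hbb : ∀ i l, ¬ adj i l → b i * b l = 0)
    (hΦ0 : Φ 0 ≤ 0) (hΦadd : ∀ x y, Φ (x + y) ≤ Φ x + Φ y) (hΦc : Continuous Φ)
    (hS₀ : ∀ i ∉ S₀, ∀ g : E, Φ (a i • g) ≤ 0)
    (hS₁a : ∀ i ∉ S₁, a i • f = 0) (hS₁b : ∀ i ∉ S₁, b i • f = 0)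
    (hc₁ : 0 ≤ c₁) (ha : ∀ i ∈ S₀, ∀ g : E, Φ (a i • g) ≤ c₁ * nrm 0 g)
    (hβ : 0 ≤ β)
    (hgr : ∀ j, good j → ∀ i, 1 ≤ i → i ≤ n₀ → ∀ g : E, nrm (i - 1) (b j • g) ≤ β * nrm i g)
    (h2 : ∀ (j) (g : E), nrm n₀ (b j • g) ≤ β * nrm n₀ g)
    (h0 : ∀ j, good j → ∀ g : E, nrm 0 (b j • g) ≤ β * nrm 0 g)
    {V : ℝ} (hV : 1 ≤ V) (h2inf : nrm n₀ f ≤ V * nrm 0 f) (hnrm : 0 ≤ nrm 0 f)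
    (hgood : ∀ (n : ℕ) (i : ι), i ∈ S₀ → ∀ ys : Fin n → ι, IsWalk adj i ys →
      ∀ t : Fin n, (t : ℕ) + 1 ≤ n₀ → good (ys t))
    (hD : ∀ j, (Finset.univ.filter fun i => adj j i).card ≤ D) (hDβ : (D : ℝ) * β ≤ Real.exp (-1))
    (hsep : ∀ (n : ℕ) (i : ι), i ∈ S₀ → ∀ ys : Fin n → ι, IsWalk adj i ys → lastPt i n ys ∈ S₁ → N ≤ n)
    (hN : r - 2 ≤ N) :
    Φ (G • f) ≤ 2 * S₀.card * c₁ * V * Real.exp 2 * Real.exp (-r) * nrm 0 f := by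
  have hlt : (D : ℝ) * β < 1 := hDβ.trans_lt (Real.exp_lt_one_iff.mpr (by norm_num))
  have h := lp_walk_bound adj hG₀ hRop hG hab hbb hΦ0 hΦadd hΦc hS₀ hS₁a hS₁b hc₁ ha hβ hgr h2 h0 hV h2inf
    hnrm hgood hD hlt hsep
  have ht := tail_222 (mul_nonneg (Nat.cast_nonneg D) hβ) hDβ hN
  have hK : 0 ≤ (S₀.card : ℝ) * c₁ * V := mul_nonneg (mul_nonneg (Nat.cast_nonneg _) hc₁) (zero_le_one.trans hV)
  calc Φ (G • f) ≤ S₀.card * c₁ * V * ((D : ℝ) * β) ^ N / (1 - D * β) * nrm 0 f := h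
    _ = S₀.card * c₁ * V * (((D : ℝ) * β) ^ N / (1 - D * β)) * nrm 0 f := by ring
    _ ≤ S₀.card * c₁ * V * (2 * Real.exp 2 * Real.exp (-r)) * nrm 0 f :=
        mul_le_mul_of_nonneg_right (mul_le_mul_of_nonneg_left ht hK) hnrm
    _ = 2 * S₀.card * c₁ * V * Real.exp 2 * Real.exp (-r) * nrm 0 f := by ring

end Series

/-! ### §4 The `ℤ^d` model: cube adjacency, `3^d` successors, `R₀` as a sup-distance condition -/

section Lattice

variable {ι : Type*} {d : ℕ}

/-- **(2.19) IN LABEL SPACE**: if every label within sup-distance `n₀` of a starting label `ω₀ ∈ S₀` is good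
(its cube is interior — what `dist({x,x'},Ω^c) ≥ R₀` buys, cf. `reach_219`), then along every cube-walk from
`S₀` the labels at printed positions `≤ n₀` are good: *"all □_{ω_i} are cubes contained in Ω. The same of course
holds for the first n₀ elements of the sequences ω in the second sum."* [cite: Balaban1983RegularityDecay,
(2.19) p.578] -/
theorem good_of_reach (pos : ι → Fin d → ℤ) {good : ι → Prop} {S₀ : Finset ι} {n₀ : ℕ}
    (hR₀ : ∀ i ∈ S₀, ∀ j, (∀ μ, |pos i μ - pos j μ| ≤ n₀) → good j) :
    ∀ (n : ℕ) (i : ι), i ∈ S₀ → ∀ ys : Fin n → ι, IsWalk (cubeAdj pos) i ys →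
      ∀ t : Fin n, (t : ℕ) + 1 ≤ n₀ → good (ys t) := by
  intro n i hi ys hw t ht
  refine hR₀ i hi (ys t) fun μ => (prefix_displacement pos n i ys hw t μ).trans ?_
  exact_mod_cast ht

/-- **(2.18)–(2.22) ON `ℤ^d`**: the exponential form of the abstract bound for the printed cube adjacency
(`D = 3^d` successors, injective labels), the separation *"n ≥ M^{−1}dist({x,x'}, supp f) − 2"* expressed as
sup-distance `≥ N ≥ r − 2` between `S₀ ∋ ω₀` and `S₁ ∋ ω_n`, `R₀` as "labels within `n₀` of `S₀` are good", and
*"3^dc₂O(1)M^{−1} ≤ e^{−1}"*: `Φ(G • f) ≤ 2|S₀|c₁Ve²e^{−r}‖f‖_∞`.  All analytic inputs (Lemmas 2.1, 2.2, (2.12),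
locality) are hypotheses. [cite: Balaban1983RegularityDecay, (2.18)–(2.21) p.578, (2.22) p.579] -/
theorem lattice_lp_walk_bound {R : Type*} [Ring R] [TopologicalSpace R] {E : Type*} [AddCommGroup E]
    [Module R E] [TopologicalSpace E] [ContinuousSMul R E] [Fintype ι] [DecidableEq ι]
    (pos : ι → Fin d → ℤ) (hpos : Function.Injective pos)
    {a b : ι → R} {G G₀ Rop : R} {f : E} {Φ : E → ℝ} {nrm : ℕ → E → ℝ} {good : ι → Prop}
    {S₀ S₁ : Finset ι} {c₁ β r : ℝ} {N n₀ : ℕ}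
    (hG₀ : G₀ = ∑ i, a i) (hRop : Rop = ∑ i, b i) (hG : HasSum (fun n : ℕ => G₀ * Rop ^ n) G)
    (hab : ∀ i l, ¬ cubeAdj pos i l → a i * b l = 0) (hbb : ∀ i l, ¬ cubeAdj pos i l → b i * b l = 0)
    (hΦ0 : Φ 0 ≤ 0) (hΦadd : ∀ x y, Φ (x + y) ≤ Φ x + Φ y) (hΦc : Continuous Φ)
    (hS₀ : ∀ i ∉ S₀, ∀ g : E, Φ (a i • g) ≤ 0)
    (hS₁a : ∀ i ∉ S₁, a i • f = 0) (hS₁b : ∀ i ∉ S₁, b i • f = 0)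
    (hc₁ : 0 ≤ c₁) (ha : ∀ i ∈ S₀, ∀ g : E, Φ (a i • g) ≤ c₁ * nrm 0 g)
    (hβ : 0 ≤ β)
    (hgr : ∀ j, good j → ∀ i, 1 ≤ i → i ≤ n₀ → ∀ g : E, nrm (i - 1) (b j • g) ≤ β * nrm i g)
    (h2 : ∀ (j) (g : E), nrm n₀ (b j • g) ≤ β * nrm n₀ g)
    (h0 : ∀ j, good j → ∀ g : E, nrm 0 (b j • g) ≤ β * nrm 0 g)
    {V : ℝ} (hV : 1 ≤ V) (h2inf : nrm n₀ f ≤ V * nrm 0 f) (hnrm : 0 ≤ nrm 0 f)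
    (hR₀ : ∀ i ∈ S₀, ∀ j, (∀ μ, |pos i μ - pos j μ| ≤ n₀) → good j)
    (h3β : (3 : ℝ) ^ d * β ≤ Real.exp (-1))
    (hsep : ∀ i ∈ S₀, ∀ l ∈ S₁, ∃ μ, (N : ℤ) ≤ |pos i μ - pos l μ|) (hN : r - 2 ≤ N) :
    Φ (G • f) ≤ 2 * S₀.card * c₁ * V * Real.exp 2 * Real.exp (-r) * nrm 0 f :=
  lp_walk_bound_exp (cubeAdj pos) hG₀ hRop hG hab hbb hΦ0 hΦadd hΦc hS₀ hS₁a hS₁b hc₁ ha hβ hgr h2 h0 hV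
    h2inf hnrm (good_of_reach pos hR₀) (card_cubeAdj_le pos hpos) (D := 3 ^ d) (by exact_mod_cast h3β)
    (le_length_of_separated pos hsep) hN

end Lattice

end Literature.MathematicalPhysics.QuantumFieldTheory.Balaban1983to89.B4LpChain221
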